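import Summits.QuantumFields.YangMills.Theorems.BalabanUVNodesN06AtRecord11ObligationsW38

/-!
# BalabanUVNodes ∕ N06 ([B9], `Dag.B9_main`) — OBLIGATIONS OF THE STAGE-11 CERTIFICATE KNIT AT THE RECORD, III:
# the Theorem-3.14 leaf `t314` (unrestricted sup reading) FROM the leaf `t314loc` (restricted, local reading) AT THE RECORD —
# dag-n06-a's `B9Thm314Unrestricted` with the three sign facts of the genuine norms DISCHARGED on `geo9Y`

Track A of `YM-PLAN.md` (cell `pub-ymgap`, HUMAN RULING D-0062), node **N06** = [Balaban1985BackgroundPropagators] Thms 3.1–3.15; seat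
`pub-ymgap-dag-n06-d` gen 2 = dag-lead N06-ASSIGNMENT v1 (P3) «THE KNIT AT THE RECORD».  Sequel of `BalabanUVNodesN06AtRecord11ObligationsW38` (p457661).

THE POINT.  The ₁₁ certificate (`N06AtRecord11CB10YZW.b9_main_of_up_view₁₁B10YZW_of_obligations`, p449575) carries Theorem 3.14 TWICE: `t314 : B9.Thm314Printed …
Kdiff dOmegaY` (sup entries, NO localisation restriction) and `t314loc : B9Thm314.Thm314LocalPrinted … Kdiff OmKY dOmegaY` (sup + L² + Hölder entries for
y, y′ ∈ Ω^{(k)}) — N06-ASSIGNMENT rows 22 and 23.  dag-n06-a's `B9Thm314Unrestricted.thm314Printed_of_supOn` ∕ `_of_local` (typed-leaf flag T314 part (i)) proved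
`t314 ⇐ t314loc`'s sup part + (β) the PLAIN sup bound (3.42) for the difference operator + (γ) the geometry of (3.154) off the restriction, GIVEN the model signs as the
structure `B9FromB6.ModelSigns (geo i)` — which is NOT constructible at the record's geometry `geo9Y` (dag-n03-b HAZARD-1: its `holder_mono` field fails on `geo9K`'s
site summand).  Its proof, however, reads only three sign facts — `L^jη ≥ 0`, `|λ| ≥ 0`, `d ≥ 0` — all THEOREMS on the genuine lattice norms (3.39)–(3.41) of the
record (`B6KLevelCensusIndexV1.len_pos`, `B9GeoNormsKLevelV1.geo9K_supNorm_nonneg`, `geo9K_dist_nonneg`), and `d(y, y′, Ω) ≥ 0` is def-Y's `dOmegaY_nonneg`.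

WHAT THIS MODULE DOES (kernel bookkeeping; 0 `def`, 0 `sorry`, standard axioms; COUNT-NEUTRAL, `--supports` K1 `StabilityBAtRecordR11e`):
* §1–§2 `thm314Printed_of_supOn_signs` ∕ `thm314Printed_of_local_signs` — dag-n06-a's two theorems RE-STATED with the three sign facts as hypotheses in place of the
  `ModelSigns` structure (proof adapted verbatim from `B9Thm314Unrestricted`; same constants δ₀ ↦ min(δ₀, ½δ₁), B₀ ↦ max(B₀, B₁e^{δ₀′r})).
* §3 `t314_obligation_of_t314loc` — ROW 22 FROM ROW 23 AT THE RECORD: `B9.Thm314Printed c35Y geo9Y bg9Y (fun x => (ops x).Kdiff) dOmegaY` from `t314loc` + (β) + (γ),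
  the four sign facts DISCHARGED.  (β) and (γ) stay DISPLAYED: (β) = Theorem 3.1 for the two operators of the two sequences + the triangle inequality (an
  operator-layer law, row 22's residual); (γ) = `¬(OmKY x y ∧ OmKY x y′) → dOmegaY x y y′ ≤ (geo9Y x).dist y y′ + r` for one fixed `r` (a fact about the record's tori:
  `dOmegaY` is p21's `dOmega` on `k`-block labels in units of `Lᵏ`, `(geo9Y x).dist` the admissible-contour distance (2.46) of the carrier blocks — the comparison
  `B9Thm314GpFlatTorusGeometry.dOmega_le_of_witness` is the template; not proved here).
* §4 `b9_main_of_up_view₁₁B10YZW_of_obligations_W38T314supplied` — THE ₁₁ CERTIFICATE with `t37`, `c38`, the (3.42) half of `hsum` AND `t314` SUPPLIED: 24 operator-layer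
  obligations + the walk pin ∕ schemas ∕ readings ∕ locality ∕ co-readings ∕ residual of the sequel + (β) + (γ), displayed and nothing else.

HONEST FRAMING.  Typing-strength bookkeeping between two fields of the same leaf, at the record; T314 part (ii) (M-uniformity of the adjusted rate, GAPS G-B9-08 ∕
G-B9-19) is UNTOUCHED and stands on `t314loc` exactly as before.  Nothing of [B9] is proved for Bałaban's operators; no `OpsY` ∕ `Ops` instance over the record's lattice
operators exists in the tree; k stays 0 ∕ 28 in the referee's sense; N06 is NOT discharged.  One finite four-torus programme at fixed `ε` — NOT ℝ⁴, NOT OS, NOT a mass gap,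
NOT Clay.  No `def`.
-/

noncomputable section

namespace Summit.QuantumFields.YangMills.BalabanUVNodes.N06AtRecord11ObligationsT314

open Literature.MathematicalPhysics.QuantumFieldTheory.Balaban1983to89
open Literature.MathematicalPhysics.QuantumFieldTheory.Balaban1983to89.T4Continuum (T4Family FiniteEpsData)
open Literature.MathematicalPhysics.QuantumFieldTheory.Balaban1983to89.DagBinding (WorldP leavesP B9LeafX)
open Literature.MathematicalPhysics.QuantumFieldTheory.Balaban1983to89.Node00
open Literature.MathematicalPhysics.QuantumFieldTheory.Balaban1983to89.B9PinMembersKLevelV1 (MemberY geo9Y bg9Y)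
open Literature.MathematicalPhysics.QuantumFieldTheory.Balaban1983to89.B9PinGeometryKLevelV1 (dOmegaY OmKY inΛY unitDistY InCubeY c35Y dOmegaY_nonneg)
open Literature.MathematicalPhysics.QuantumFieldTheory.Balaban1983to89.B7Prop2SpecialUnitary (specialUnitaryUnits)
open Literature.MathematicalPhysics.QuantumFieldTheory.Balaban1983to89.B9Thm37Whole (Ops Conv342 Sizes StaticOK Local342 Identities const37)
open Literature.MathematicalPhysics.QuantumFieldTheory.Balaban1983to89.B9Cor38Whole (WalkReading Locality W38OfOps)
open Literature.MathematicalPhysics.QuantumFieldTheory.Balaban1983to89.B9Thm37GlueCor36 (CoRealizes)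
open Literature.MathematicalPhysics.QuantumFieldTheory.Balaban1983to89.B6RandomWalk (Ineq261)
open Literature.MathematicalPhysics.QuantumFieldTheory.Balaban1983to89.B9Thm34Ext (toB6)
open Literature.MathematicalPhysics.QuantumFieldTheory.Balaban1983to89.B9Thm314 (Thm314SupOn Thm314LocalPrinted IneqSupF supOn_of_local)
open Literature.MathematicalPhysics.QuantumFieldTheory.Balaban1983to89.B9GeoNormsKLevelV1 (geo9K_dist_nonneg geo9K_supNorm_nonneg)
open Literature.MathematicalPhysics.QuantumFieldTheory.Balaban1983to89.B6KLevelCensusIndexV1 (len_pos)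
open Summit.QuantumFields.YangMills.BalabanUVNodes.N06AtRecord11ObligationsW38 (b9_main_of_up_view₁₁B10YZW_of_obligations_W38supplied)
open scoped Matrix.Norms.L2Operator

variable {N : ℕ}

/-! ## §1 arithmetic (adapted from `B9Thm314Unrestricted`, whose copies are `private`) -/

/-- Off the restriction a plain decay e^{−δ₁d} pays for the extra factor e^{−δ′d_Ω} at half the rate and the constant e^{δ′r}, as soon as d_Ω ≤ d + r and 2δ′ ≤ δ₁.
[folklore] -/
private theorem exp_split_offRestriction {δ δ₁ d dΩ r : ℝ} (hδ : 0 ≤ δ) (h2 : 2 * δ ≤ δ₁) (hd : 0 ≤ d) (hΩ : dΩ ≤ d + r) :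
    Real.exp (-(δ₁ * d)) ≤ Real.exp (δ * r) * (Real.exp (-(δ * d)) * Real.exp (-(δ * dΩ))) := by
  rw [← Real.exp_add, ← Real.exp_add]
  apply Real.exp_le_exp.2
  nlinarith [mul_nonneg (sub_nonneg.2 h2) hd, mul_nonneg hδ (sub_nonneg.2 hΩ)]

/-- Weakening of a bound q ≤ c·p·e^{−δt}·e^{−δu}·m in the constant (c ≤ c′) and the rate (δ′ ≤ δ), for p, m, t, u ≥ 0. [folklore] -/
private theorem mono_twoFactor {q c c' p δ δ' t u m : ℝ} (h : q ≤ c * p * Real.exp (-(δ * t)) * Real.exp (-(δ * u)) * m)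
    (hc : c ≤ c') (hc' : 0 ≤ c') (hp : 0 ≤ p) (hm : 0 ≤ m) (hδ : δ' ≤ δ) (ht : 0 ≤ t) (hu : 0 ≤ u) :
    q ≤ c' * p * Real.exp (-(δ' * t)) * Real.exp (-(δ' * u)) * m := by
  refine h.trans ?_
  have e1 : Real.exp (-(δ * t)) ≤ Real.exp (-(δ' * t)) := B9FromB6.decay_mono hδ ht
  have e2 : Real.exp (-(δ * u)) ≤ Real.exp (-(δ' * u)) := B9FromB6.decay_mono hδ hu
  have h1 : c * p ≤ c' * p := mul_le_mul_of_nonneg_right hc hp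
  have h2 : c * p * Real.exp (-(δ * t)) ≤ c' * p * Real.exp (-(δ' * t)) :=
    mul_le_mul h1 e1 (Real.exp_nonneg _) (mul_nonneg hc' hp)
  have h3 : c * p * Real.exp (-(δ * t)) * Real.exp (-(δ * u)) ≤ c' * p * Real.exp (-(δ' * t)) * Real.exp (-(δ' * u)) :=
    mul_le_mul h2 e2 (Real.exp_nonneg _) (mul_nonneg (mul_nonneg hc' hp) (Real.exp_nonneg _))
  exact mul_le_mul_of_nonneg_right h3 hm

/-! ## §2 dag-n06-a's Theorem-3.14 transport with the three sign facts as hypotheses (generic) -/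

section Generic

variable {I : Type} {c35 : ℝ} {geo : I → B9.Geometry} {bg : I → B9.Backgrounds} {Kdiff : ∀ i, B9.KernelFamily (geo i) (bg i)}
  {OmK : ∀ i, (geo i).Site → Prop} {dOmega : ∀ i, (geo i).Site → (geo i).Site → ℝ}

/-- **Theorem 3.14 typed WITHOUT the localisation restriction (`B9.Thm314Printed`) ⇐ the printed RESTRICTED sup reading (`B9Thm314.Thm314SupOn`)** — dag-n06-a's
`B9Thm314Unrestricted.thm314Printed_of_supOn` with the `ModelSigns` structure replaced by the three sign facts its proof reads (`L^jη ≥ 0`, `|λ| ≥ 0`, `d ≥ 0`) plus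
`d(y, y′, Ω) ≥ 0`; (γ) off the restriction `d(y, y′, Ω) ≤ d(y, y′) + r`; (β) the plain sup bound with no extra factor.  Constants: M₅ ↦ max, a₀ ↦ min, δ₀ ↦ min(δ₀, ½δ₁),
B₀ ↦ max(B₀, B₁e^{δ₀′r}). [cite: Balaban1985BackgroundPropagators, Thm 3.14 (3.154) pp.426–427 (bookkeeping: restricted ⇒ unrestricted typed reading)] -/
theorem thm314Printed_of_supOn_signs (hOn : Thm314SupOn c35 geo bg Kdiff OmK dOmega)
    (hlen : ∀ (i : I) (y : (geo i).Site), 0 ≤ (geo i).len y) (hsup : ∀ (i : I) (lam : (geo i).Loc), 0 ≤ (geo i).supNorm lam)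
    (hdist : ∀ (i : I) (y y' : (geo i).Site), 0 ≤ (geo i).dist y y') (hΩ : ∀ (i : I) (y y' : (geo i).Site), 0 ≤ dOmega i y y')
    (r : ℝ) (hgeo : ∀ (i : I) (y y' : (geo i).Site), ¬ (OmK i y ∧ OmK i y') → dOmega i y y' ≤ (geo i).dist y y' + r)
    (hplain : ∃ M₁ δ₁ a₁ B₁ : ℝ, 0 < M₁ ∧ 0 < δ₁ ∧ 0 < a₁ ∧ 0 < B₁ ∧
      ∀ i : I, M₁ ≤ (geo i).M → ∀ α₀ : ℝ, 0 < α₀ → (geo i).M * α₀ ≤ a₁ →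
        ∀ U : (bg i).Cfg, (bg i).Reg335 c35 α₀ U → IneqSupF (Kdiff i) B₁ δ₁ (fun _ => True) (fun _ _ => 1) U) :
    B9.Thm314Printed c35 geo bg Kdiff dOmega := by
  -- adapted from Literature/…/B9Thm314Unrestricted.lean (dag-n06-a), `S i` ↦ the three sign hypotheses
  obtain ⟨M₅, δ, a₀, B, hM5, hδ, ha0, hB, H⟩ := hOn
  obtain ⟨M₁, δ₁, a₁, B₁, hM1, hδ1, ha1, hB1, H1⟩ := hplain
  have hδ' : 0 < min δ (δ₁ / 2) := lt_min hδ (half_pos hδ1)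
  have hδ'δ : min δ (δ₁ / 2) ≤ δ := min_le_left _ _
  have h2δ' : 2 * min δ (δ₁ / 2) ≤ δ₁ := by linarith [min_le_right δ (δ₁ / 2)]
  refine ⟨max M₅ M₁, min δ (δ₁ / 2), min a₀ a₁, max B (B₁ * Real.exp (min δ (δ₁ / 2) * r)), lt_max_of_lt_left hM5, hδ',
    lt_min ha0 ha1, lt_max_of_lt_left hB, ?_⟩
  intro i hMi α₀ hα hMa U hU n lam y y' hs
  have hpref : 0 ≤ B9.pref4 ((geo i).len y) n := B9FromB6.pref4_nonneg (hlen i y) n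
  have hsup' : 0 ≤ (geo i).supNorm lam := hsup i lam
  have hd : 0 ≤ (geo i).dist y y' := hdist i y y'
  have hB' : 0 ≤ max B (B₁ * Real.exp (min δ (δ₁ / 2) * r)) := le_trans hB.le (le_max_left _ _)
  by_cases hyy : OmK i y ∧ OmK i y'
  · have h := H i (le_trans (le_max_left _ _) hMi) α₀ hα (le_trans hMa (min_le_left _ _)) U hU n lam y y' hyy.1 hyy.2 hs
    exact mono_twoFactor h (le_max_left _ _) hB' hpref hsup' hδ'δ hd (hΩ i y y')
  · have h := H1 i (le_trans (le_max_right _ _) hMi) α₀ hα (le_trans hMa (min_le_right _ _)) U hU n lam y y' trivial trivial hs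
    have key := exp_split_offRestriction hδ'.le h2δ' hd (hgeo i y y' hyy)
    have hBB : B₁ * Real.exp (min δ (δ₁ / 2) * r) ≤ max B (B₁ * Real.exp (min δ (δ₁ / 2) * r)) := le_max_right _ _
    calc (Kdiff i).e n U lam y
        ≤ B₁ * B9.pref4 ((geo i).len y) n * Real.exp (-(δ₁ * (geo i).dist y y')) * 1 * (geo i).supNorm lam := h
      _ ≤ B₁ * B9.pref4 ((geo i).len y) n * (Real.exp (min δ (δ₁ / 2) * r) *
            (Real.exp (-(min δ (δ₁ / 2) * (geo i).dist y y')) * Real.exp (-(min δ (δ₁ / 2) * dOmega i y y')))) * 1 *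
            (geo i).supNorm lam := by
          apply mul_le_mul_of_nonneg_right _ hsup'
          apply mul_le_mul_of_nonneg_right _ zero_le_one
          exact mul_le_mul_of_nonneg_left key (mul_nonneg hB1.le hpref)
      _ = B₁ * Real.exp (min δ (δ₁ / 2) * r) * B9.pref4 ((geo i).len y) n * Real.exp (-(min δ (δ₁ / 2) * (geo i).dist y y')) *
            Real.exp (-(min δ (δ₁ / 2) * dOmega i y y')) * (geo i).supNorm lam := by ring
      _ ≤ max B (B₁ * Real.exp (min δ (δ₁ / 2) * r)) * B9.pref4 ((geo i).len y) n * Real.exp (-(min δ (δ₁ / 2) * (geo i).dist y y')) *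
            Real.exp (-(min δ (δ₁ / 2) * dOmega i y y')) * (geo i).supNorm lam := by
          apply mul_le_mul_of_nonneg_right _ hsup'
          apply mul_le_mul_of_nonneg_right _ (Real.exp_nonneg _)
          apply mul_le_mul_of_nonneg_right _ (Real.exp_nonneg _)
          exact mul_le_mul_of_nonneg_right hBB hpref

/-- **The same from the leaf's LOCAL reading `B9Thm314.Thm314LocalPrinted`** (its sup part, `B9Thm314.supOn_of_local`) — dag-n06-a's `thm314Printed_of_local` with the
sign facts as hypotheses. [cite: Balaban1985BackgroundPropagators, Thm 3.14 (3.154) pp.426–427 (bookkeeping)] -/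
theorem thm314Printed_of_local_signs (hloc : Thm314LocalPrinted c35 geo bg Kdiff OmK dOmega)
    (hlen : ∀ (i : I) (y : (geo i).Site), 0 ≤ (geo i).len y) (hsup : ∀ (i : I) (lam : (geo i).Loc), 0 ≤ (geo i).supNorm lam)
    (hdist : ∀ (i : I) (y y' : (geo i).Site), 0 ≤ (geo i).dist y y') (hΩ : ∀ (i : I) (y y' : (geo i).Site), 0 ≤ dOmega i y y')
    (r : ℝ) (hgeo : ∀ (i : I) (y y' : (geo i).Site), ¬ (OmK i y ∧ OmK i y') → dOmega i y y' ≤ (geo i).dist y y' + r)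
    (hplain : ∃ M₁ δ₁ a₁ B₁ : ℝ, 0 < M₁ ∧ 0 < δ₁ ∧ 0 < a₁ ∧ 0 < B₁ ∧
      ∀ i : I, M₁ ≤ (geo i).M → ∀ α₀ : ℝ, 0 < α₀ → (geo i).M * α₀ ≤ a₁ →
        ∀ U : (bg i).Cfg, (bg i).Reg335 c35 α₀ U → IneqSupF (Kdiff i) B₁ δ₁ (fun _ => True) (fun _ _ => 1) U) :
    B9.Thm314Printed c35 geo bg Kdiff dOmega :=
  thm314Printed_of_supOn_signs (supOn_of_local hloc) hlen hsup hdist hΩ r hgeo hplain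

end Generic

/-! ## §3 row 22 (`t314`) FROM row 23 (`t314loc`) AT THE RECORD'S [B9] BUNDLE -/

section AtBundle

variable (θ₃ : Stage3Params) (Mstar : ℕ) (ops : OpsY N θ₃ Mstar)

/-- **THE `t314` OBLIGATION OF THE CERTIFICATE FROM ITS `t314loc` OBLIGATION, AT THE RECORD** — the sign facts `L^jη ≥ 0`, `|λ| ≥ 0`, `d ≥ 0` of the genuine
lattice norms (3.39)–(3.41) on `geo9Y` and `d(y, y′, Ω) ≥ 0` (`dOmegaY_nonneg`) DISCHARGED; DISPLAYED: (γ) off the restriction `Ω^{(k)}` the distance (3.154) of the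
member exceeds the admissible-contour distance of the carrier blocks by at most `r`, and (β) the PLAIN sup bound (3.42) (no extra factor) for the difference kernel
family `(ops x).Kdiff` under thresholds of Theorem 3.1's kind (print: Theorem 3.1 for each of the two operators + the triangle inequality).  So at the record row 22
costs (β) + (γ) beyond row 23; T314 part (ii) untouched. [cite: Balaban1985BackgroundPropagators, Thm 3.14 (3.154) pp.426–427, Thm 3.1 (3.42) p.397, (3.39)–(3.41) p.397] -/
theorem t314_obligation_of_t314loc (r : ℝ)
    (hgeo : ∀ (x : MemberY θ₃.d₆ θ₃.ℓ₆ θ₃.hd' θ₃.hL' θ₃.b₀ θ₃.b₁ Mstar) (y y' : (geo9Y x).Site), ¬ (OmKY x y ∧ OmKY x y') →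
      dOmegaY x y y' ≤ (geo9Y x).dist y y' + r)
    (t314loc : Thm314LocalPrinted c35Y geo9Y (bg9Y (Matrix (Fin N) (Fin N) ℂ) (specialUnitaryUnits (Fin N))) (fun x => (ops x).Kdiff) OmKY dOmegaY)
    (hplain : ∃ M₁ δ₁ a₁ B₁ : ℝ, 0 < M₁ ∧ 0 < δ₁ ∧ 0 < a₁ ∧ 0 < B₁ ∧
      ∀ x : MemberY θ₃.d₆ θ₃.ℓ₆ θ₃.hd' θ₃.hL' θ₃.b₀ θ₃.b₁ Mstar, M₁ ≤ (geo9Y x).M → ∀ α₀ : ℝ, 0 < α₀ → (geo9Y x).M * α₀ ≤ a₁ →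
        ∀ U : (bg9Y (Matrix (Fin N) (Fin N) ℂ) (specialUnitaryUnits (Fin N)) x).Cfg,
          (bg9Y (Matrix (Fin N) (Fin N) ℂ) (specialUnitaryUnits (Fin N)) x).Reg335 c35Y α₀ U → IneqSupF (ops x).Kdiff B₁ δ₁ (fun _ => True) (fun _ _ => 1) U) :
    B9.Thm314Printed c35Y geo9Y (bg9Y (Matrix (Fin N) (Fin N) ℂ) (specialUnitaryUnits (Fin N))) (fun x => (ops x).Kdiff) dOmegaY :=
  thm314Printed_of_local_signs t314loc (fun x y => (len_pos x.toKIdx y).le) (fun x lam => geo9K_supNorm_nonneg x.toKIdx lam)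
    (fun x y y' => geo9K_dist_nonneg x.toKIdx y y') (fun x y y' => dOmegaY_nonneg x y y') r hgeo hplain

end AtBundle

/-! ## §4 THE KNIT AT ₁₁ with `t37`, `c38`, the (3.42) half of `hsum` and `t314` SUPPLIED -/

section Pointed

variable [NeZero N] {F : T4Family}

/-- **THE ₁₁ CERTIFICATE WITH `t37`, `c38`, THE (3.42) HALF OF `hsum` AND `t314` SUPPLIED.**  `Dag.B9_main` at every run of a world bound over the four-pin Stage-11 view
of the package `(θ, M⋆, ops, ζ, λ_W)` FROM: 24 obligations of `N06AtRecord11CB10YZW.b9_main_of_up_view₁₁B10YZW_of_obligations` verbatim; the walk pin, n06-c's schemas ∕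
readings ∕ locality inputs, the co-readings and the residual of the summation leaf exactly as in `N06AtRecord11ObligationsW38.…_W38supplied`; and, in place of `t314`,
(γ) + (β) of §3 (`t314loc` stays displayed and now carries Theorem 3.14 alone).  Displayed and nothing else; NOT a discharge of N06.
[cite: Balaban1985BackgroundPropagators, Thms 3.1–3.15 pp.397–432; Thm 3.14 (3.154) pp.426–427; Thm 3.7 (3.90) pp.409–410, Cor. 3.8 p.410, Cor. 3.6 p.408, (3.35) p.396, (3.42)–(3.47) pp.397–398; Balaban1984PropagatorsII, Lemma 2.1 (2.61) p.234, Props. 2.2–2.7 pp.234–249] -/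
theorem b9_main_of_up_view₁₁B10YZW_of_obligations_W38T314supplied (θ : Stage11Params F N) (hθ : θ.Admissible) (Mstar : ℕ)
    (ops : OpsY N θ.toStage3Params Mstar) (ζ : ResidZ F N) (lamW : ResidW F N) (w : WorldP)
    (hup : ∀ P, w.up P = upOfRecord₅C F N (θ.view₁₁B10YZW F N Mstar ops ζ lamW) P)
    (hGp_e : ∀ (x : MemberY θ.d₆ θ.ℓ₆ θ.hd' θ.hL' θ.b₀ θ.b₁ Mstar) (n : Fin 4) (lam : (geo9Y x).Loc) (y : (geo9Y x).Site),
      (ops x).Gp.e n (bg9Y (Matrix (Fin N) (Fin N) ℂ) (specialUnitaryUnits (Fin N)) x).one lam y ≤ (Node00.GpU x.toKIdx).e n lam y)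
    (hGp_h1 : ∀ (x : MemberY θ.d₆ θ.ℓ₆ θ.hd' θ.hL' θ.b₀ θ.b₁ Mstar) (lam : (geo9Y x).Loc) (b : ℝ) (c : (geo9Y x).Cut),
      (ops x).Gp.h1 (bg9Y (Matrix (Fin N) (Fin N) ℂ) (specialUnitaryUnits (Fin N)) x).one lam b c ≤ (Node00.GpU x.toKIdx).h1 lam b c)
    (hC : ∀ (x : MemberY θ.d₆ θ.ℓ₆ θ.hd' θ.hL' θ.b₀ θ.b₁ Mstar) (y y' : (geo9Y x).Site),
      |(ops x).Cinv.ker (bg9Y (Matrix (Fin N) (Fin N) ℂ) (specialUnitaryUnits (Fin N)) x).one y y'| ≤ |(Node00.CinvU x.toKIdx).ker y y'|)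
    (hGA_e : ∀ (x : MemberY θ.d₆ θ.ℓ₆ θ.hd' θ.hL' θ.b₀ θ.b₁ Mstar) (n : Fin 4) (lam : (geo9Y x).Loc) (y : (geo9Y x).Site),
      (ops x).GA.e n (bg9Y (Matrix (Fin N) (Fin N) ℂ) (specialUnitaryUnits (Fin N)) x).one lam y ≤ (Node00.GU x.toKIdx).e n lam y)
    (hGA_h1 : ∀ (x : MemberY θ.d₆ θ.ℓ₆ θ.hd' θ.hL' θ.b₀ θ.b₁ Mstar) (lam : (geo9Y x).Loc) (b : ℝ) (c : (geo9Y x).Cut),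
      (ops x).GA.h1 (bg9Y (Matrix (Fin N) (Fin N) ℂ) (specialUnitaryUnits (Fin N)) x).one lam b c ≤ (Node00.GU x.toKIdx).h1 lam b c)
    (hGA_e4 : ∀ (x : MemberY θ.d₆ θ.ℓ₆ θ.hd' θ.hL' θ.b₀ θ.b₁ Mstar) (lam : (geo9Y x).Loc) (y : (geo9Y x).Site),
      (ops x).GA.e4 (bg9Y (Matrix (Fin N) (Fin N) ℂ) (specialUnitaryUnits (Fin N)) x).one lam y ≤ (Node00.GU x.toKIdx).e4 lam y)
    (hGA_h2 : ∀ (x : MemberY θ.d₆ θ.ℓ₆ θ.hd' θ.hL' θ.b₀ θ.b₁ Mstar) (lam : (geo9Y x).Loc) (b : ℝ) (c : (geo9Y x).Cut),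
      (ops x).GA.h2 (bg9Y (Matrix (Fin N) (Fin N) ℂ) (specialUnitaryUnits (Fin N)) x).one lam b c ≤ (Node00.GU x.toKIdx).h2 lam b c)
    (hGA_l2 : ∀ (x : MemberY θ.d₆ θ.ℓ₆ θ.hd' θ.hL' θ.b₀ θ.b₁ Mstar) (n : Fin 6) (lam : (geo9Y x).Loc) (hc : (geo9Y x).Cut),
      (ops x).GA.l2 n (bg9Y (Matrix (Fin N) (Fin N) ℂ) (specialUnitaryUnits (Fin N)) x).one lam hc ≤ (Node00.GU x.toKIdx).l2 n lam hc)
    (hE4 : ∀ (x : MemberY θ.d₆ θ.ℓ₆ θ.hd' θ.hL' θ.b₀ θ.b₁ Mstar) (lam : (geo9Y x).Loc), ¬ (lam.isRight = true) →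
      ∀ y, (ops x).GA.e4 (bg9Y (Matrix (Fin N) (Fin N) ℂ) (specialUnitaryUnits (Fin N)) x).one lam y ≤ 0)
    (hH2 : ∀ (x : MemberY θ.d₆ θ.ℓ₆ θ.hd' θ.hL' θ.b₀ θ.b₁ Mstar) (lam : (geo9Y x).Loc), ¬ (lam.isRight = true) →
      ∀ (β : ℝ) (c : (geo9Y x).Cut), (ops x).GA.h2 (bg9Y (Matrix (Fin N) (Fin N) ℂ) (specialUnitaryUnits (Fin N)) x).one lam β c ≤ 0)
    (hGp : B9FromB6.ResidualGpAtOne geo9Y (bg9Y (Matrix (Fin N) (Fin N) ℂ) (specialUnitaryUnits (Fin N))) (fun x => (ops x).Gp))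
    (hGA : B9FromB6.ResidualGAGlobAtOne geo9Y (bg9Y (Matrix (Fin N) (Fin N) ℂ) (specialUnitaryUnits (Fin N))) (fun x => (ops x).GA))
    (hB : B9.SectBStepPrinted (θ.d₆ + 1) c35Y geo9Y (bg9Y (Matrix (Fin N) (Fin N) ℂ) (specialUnitaryUnits (Fin N))) (fun x => (ops x).Gp)
      (fun x => (ops x).GA) (fun x => (ops x).Cinv) (fun x => (ops x).IsAnalyticExt))
    (hg : B9.GaugeReduction335 (θ.d₆ + 1) c35Y geo9Y (bg9Y (Matrix (Fin N) (Fin N) ℂ) (specialUnitaryUnits (Fin N))) InCubeY (fun x => (ops x).Gp)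
      (fun x => (ops x).GA) (fun x => (ops x).Cinv))
    -- in place of `t37`, `c38`, `hsum`: as in the sequel `…_W38supplied`
    [∀ x : MemberY θ.d₆ θ.ℓ₆ θ.hd' θ.hL' θ.b₀ θ.b₁ Mstar, Fintype (geo9Y x).Site]
    [∀ x : MemberY θ.d₆ θ.ℓ₆ θ.hd' θ.hL' θ.b₀ θ.b₁ Mstar, DecidableEq (geo9Y x).Site]
    {X Y ι : MemberY θ.d₆ θ.ℓ₆ θ.hd' θ.hL' θ.b₀ θ.b₁ Mstar → Type}
    [∀ x, Fintype (X x)] [∀ x, DecidableEq (X x)] [∀ x, Fintype (Y x)] [∀ x, DecidableEq (Y x)] [∀ x, Fintype (ι x)]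
    (𝔬 : ∀ x, Ops (geo9Y x) (bg9Y (Matrix (Fin N) (Fin N) ℂ) (specialUnitaryUnits (Fin N)) x) (X x) (Y x) (ι x))
    (rd : ∀ x, WalkReading (geo9Y x) (bg9Y (Matrix (Fin N) (Fin N) ℂ) (specialUnitaryUnits (Fin N)) x) (X x) (ι x))
    (R : MemberY θ.d₆ θ.ℓ₆ θ.hd' θ.hL' θ.b₀ θ.b₁ Mstar → ℝ) (H : MemberY θ.d₆ θ.ℓ₆ θ.hd' θ.hL' θ.b₀ θ.b₁ Mstar → Prop)
    (κ : MemberY θ.d₆ θ.ℓ₆ θ.hd' θ.hL' θ.b₀ θ.b₁ Mstar → Sizes) (d : ℕ) (α ρ Nc N' Cℓ K θ₀ B₀ δ₀ a₁ M₁ ML : ℝ)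
    (hα : 0 ≤ α) (hα2 : α ≤ 1 / 2) (hN : 0 ≤ Nc) (hN' : 0 ≤ N') (hCℓ : 1 ≤ Cℓ) (hK : 0 ≤ K) (hθ₀ : 0 ≤ θ₀) (hB₀ : 0 < B₀) (hδ₀ : 0 < δ₀)
    (ha₁ : 0 < a₁) (hM₁ : 0 < M₁)
    (hst : ∀ x, StaticOK (𝔬 x) ρ Nc N' Cℓ (κ x)) (hκ : ∀ x, (κ x).Bounded K θ₀ Cℓ (geo9Y x).M)
    (hrd : ∀ x, (rd x).OK (𝔬 x).blk) (hloc : ∀ x, Locality (𝔬 x) (rd x))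
    (h261 : ∀ x, ML ≤ (geo9Y x).M → Ineq261 d (toB6 (geo9Y x) (R x) (H x)) δ₀ α)
    (h36 : ∀ x, M₁ ≤ (geo9Y x).M → ∀ α₀ : ℝ, 0 < α₀ → c35Y * (geo9Y x).M * α₀ ≤ a₁ →
      ∀ U : (bg9Y (Matrix (Fin N) (Fin N) ℂ) (specialUnitaryUnits (Fin N)) x).Cfg,
        (bg9Y (Matrix (Fin N) (Fin N) ℂ) (specialUnitaryUnits (Fin N)) x).Reg335 c35Y α₀ U →
          Local342 (𝔬 x) (R x) (H x) B₀ δ₀ U ∧ Identities (𝔬 x) (R x) (H x) U)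
    (hE38 : ∀ x, (ops x).E37 = W38OfOps (𝔬 x) (rd x) (R x) (H x) (const37 d δ₀ α ρ B₀ Nc N' Cℓ K) ((1 - 2 * α) * δ₀))
    (evY : ∀ x : MemberY θ.d₆ θ.ℓ₆ θ.hd' θ.hL' θ.b₀ θ.b₁ Mstar, (geo9Y x).Loc → Y x → ℝ)
    (hco0 : ∀ x U, CoRealizes (ops x).Gp 0 U (𝔬 x).blk (𝔬 x).blk (rd x).ev ((𝔬 x).Gp U))
    (hco1 : ∀ x U, CoRealizes (ops x).Gp 1 U (𝔬 x).blkY (𝔬 x).blk (rd x).ev ((𝔬 x).D U ∘ₗ (𝔬 x).Gp U))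
    (hco2 : ∀ x U, CoRealizes (ops x).Gp 2 U (𝔬 x).blk (𝔬 x).blkY (evY x) ((𝔬 x).Gp U ∘ₗ (𝔬 x).Dstar U))
    (hco3 : ∀ x U, CoRealizes (ops x).Gp 3 U (𝔬 x).blk (𝔬 x).blk (rd x).ev ((𝔬 x).Lap U ∘ₗ (𝔬 x).Gp U))
    {B₁ δ₁ : ℝ} (hB₁ : 0 < B₁) (hδ₁ : 0 < δ₁) (hCB : const37 d δ₀ α ρ B₀ Nc N' Cℓ K ≤ B₁) (hδ₁le : δ₁ ≤ (1 - 2 * α) * δ₀)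
    {Bβ Bε : ℝ → ℝ} {Bεβ : ℝ → ℝ → ℝ}
    (hrest : ∀ (x : MemberY θ.d₆ θ.ℓ₆ θ.hd' θ.hL' θ.b₀ θ.b₁ Mstar) (U : (bg9Y (Matrix (Fin N) (Fin N) ℂ) (specialUnitaryUnits (Fin N)) x).Cfg),
      ((ops x).E37).Converges U →
        (∀ (n : Fin 6) (lam : (geo9Y x).Loc) (h : (geo9Y x).Cut) (y y' : (geo9Y x).Site), (geo9Y x).cutIn h y → (geo9Y x).suppIn lam y' →
            (ops x).Gp.l2 n U lam h ≤ B₁ * B9.pref6 ((geo9Y x).len y) n * (geo9Y x).cutSup h * Real.exp (-(δ₁ * (geo9Y x).dist y y')) * (geo9Y x).l2Norm lam) ∧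
        (∀ (n : Fin 4) (lam : (geo9Y x).Loc) (γ : ℝ), -4 ≤ γ → γ ≤ 4 → (ops x).Gp.glob n U lam γ ≤ B₁ * (geo9Y x).wNorm γ lam) ∧
        B9.Ineq343_345 (ops x).Gp Bβ Bε Bεβ δ₁ U)
    (h310 : ∀ (x : MemberY θ.d₆ θ.ℓ₆ θ.hd' θ.hL' θ.b₀ θ.b₁ Mstar) (U : (bg9Y (Matrix (Fin N) (Fin N) ℂ) (specialUnitaryUnits (Fin N)) x).Cfg),
      ((ops x).E310).Converges U → B9.Ineq342_346_347 (ops x).GA B₁ δ₁ U ∧ B9.Ineq343_345 (ops x).GA Bβ Bε Bεβ δ₁ U)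
    -- in place of `t314`: (γ) and (β) of §3
    (r : ℝ)
    (hgeo : ∀ (x : MemberY θ.d₆ θ.ℓ₆ θ.hd' θ.hL' θ.b₀ θ.b₁ Mstar) (y y' : (geo9Y x).Site), ¬ (OmKY x y ∧ OmKY x y') →
      dOmegaY x y y' ≤ (geo9Y x).dist y y' + r)
    (hplain : ∃ M₁ δ₁ a₁ B₁ : ℝ, 0 < M₁ ∧ 0 < δ₁ ∧ 0 < a₁ ∧ 0 < B₁ ∧
      ∀ x : MemberY θ.d₆ θ.ℓ₆ θ.hd' θ.hL' θ.b₀ θ.b₁ Mstar, M₁ ≤ (geo9Y x).M → ∀ α₀ : ℝ, 0 < α₀ → (geo9Y x).M * α₀ ≤ a₁ →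
        ∀ U : (bg9Y (Matrix (Fin N) (Fin N) ℂ) (specialUnitaryUnits (Fin N)) x).Cfg,
          (bg9Y (Matrix (Fin N) (Fin N) ℂ) (specialUnitaryUnits (Fin N)) x).Reg335 c35Y α₀ U → IneqSupF (ops x).Kdiff B₁ δ₁ (fun _ => True) (fun _ _ => 1) U)
    -- the remaining printed leaves, verbatim
    (t39 : B9.Thm39Printed (θ.d₆ + 1) c35Y geo9Y (bg9Y (Matrix (Fin N) (Fin N) ℂ) (specialUnitaryUnits (Fin N))) (fun x => (ops x).EK39))
    (t310 : B9.Thm310Printed c35Y geo9Y (bg9Y (Matrix (Fin N) (Fin N) ℂ) (specialUnitaryUnits (Fin N))) (fun x => (ops x).E310))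
    (hksum : B9.RWKernelSumYields (θ.d₆ + 1) geo9Y (bg9Y (Matrix (Fin N) (Fin N) ℂ) (specialUnitaryUnits (Fin N))) (fun x => (ops x).EK39)
      (fun x => (ops x).Cinv))
    (t311 : B9.Thm311Printed c35Y geo9Y (bg9Y (Matrix (Fin N) (Fin N) ℂ) (specialUnitaryUnits (Fin N))) (fun x => (ops x).PosDef))
    (t312 : B9.Thm312Printed (θ.d₆ + 1) c35Y geo9Y (bg9Y (Matrix (Fin N) (Fin N) ℂ) (specialUnitaryUnits (Fin N))) (fun x => (ops x).GD)
      (fun x => (ops x).G₁) (fun x => (ops x).H) (fun x => (ops x).H₁) (fun x => (ops x).HasRWExp) (fun x => (ops x).HasRWExpH)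
      (fun x => (ops x).PosDefK))
    (t313 : B9.Thm313Printed c35Y geo9Y (bg9Y (Matrix (Fin N) (Fin N) ℂ) (specialUnitaryUnits (Fin N))) (fun x => (ops x).GG)
      (fun x => (ops x).HasRWExp) (fun x => (ops x).PosDefK))
    (t315 : B9.Thm315FullPrinted c35Y geo9Y (bg9Y (Matrix (Fin N) (Fin N) ℂ) (specialUnitaryUnits (Fin N))) (fun x => (ops x).Ck) inΛY unitDistY
      (fun x => (ops x).GivenBy3185) (fun x => (ops x).HasRWExpC))
    (s349 : B9.Stmt349Printed (θ.d₆ + 1) c35Y geo9Y (bg9Y (Matrix (Fin N) (Fin N) ℂ) (specialUnitaryUnits (Fin N))) (fun x => (ops x).P349))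
    (s3132 : B9.Stmt3132Printed (θ.d₆ + 1) c35Y geo9Y (bg9Y (Matrix (Fin N) (Fin N) ℂ) (specialUnitaryUnits (Fin N))) (fun x => (ops x).QGQinv)
      (fun x => (ops x).QG1Qinv))
    (t314loc : Thm314LocalPrinted c35Y geo9Y (bg9Y (Matrix (Fin N) (Fin N) ℂ) (specialUnitaryUnits (Fin N))) (fun x => (ops x).Kdiff) OmKY dOmegaY)
    (P : B12.RunParams) : Dag.B9_main (leavesP w P) :=
  b9_main_of_up_view₁₁B10YZW_of_obligations_W38supplied θ hθ Mstar ops ζ lamW w hup hGp_e hGp_h1 hC hGA_e hGA_h1 hGA_e4 hGA_h2 hGA_l2 hE4 hH2 hGp hGA hB hg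
    𝔬 rd R H κ d α ρ Nc N' Cℓ K θ₀ B₀ δ₀ a₁ M₁ ML hα hα2 hN hN' hCℓ hK hθ₀ hB₀ hδ₀ ha₁ hM₁ hst hκ hrd hloc h261 h36 hE38 evY hco0 hco1 hco2 hco3
    hB₁ hδ₁ hCB hδ₁le hrest h310 t39 t310 hksum t311 t312 t313
    (t314_obligation_of_t314loc θ.toStage3Params Mstar ops r hgeo t314loc hplain)
    t315 s349 s3132 t314loc P

end Pointed

end Summit.QuantumFields.YangMills.BalabanUVNodes.N06AtRecord11ObligationsT314

end
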